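import Summits.Ventures.PercRepro.C026AcyclicDFree

/-!
# Forests are D-free, part 3: the injection `Φ` and THEOREM F (p6, gen 10)

* `Acyclic.carries_b_of_carries_a` — the case-1 invariant: on a `KL`-configuration in which `c` carries a
  closed edge to `K`, `c` is the carrier, so it also carries one to `L`;
* `klWitness` (a chosen `KLWitness`), `phi`: `S ↦ S` when `c` itself carries a closed edge to `K`, else
  `S ↦ T`; `phi_mem` (the image lies in `A`, by Claim 2), `phi_inj` (the two cases are told apart by
  `Carries · c b`; in the second case `eL`, `x`, `e₁`, `eK` are recovered from `T` by (U1) and (L6));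
* **`Acyclic.card_botM_le`** (`#KL ≤ #A`) and **`Acyclic.dFreeIneq`** — THEOREM F: on an acyclic marked
  multigraph the D-free inequality holds, for any marks.
-/

namespace PercRepro

open Finset

namespace MultiGraph

variable {V E : Type*} {G : MultiGraph V E}

/-! ### The injection `Φ` and the theorem -/

/-- **The case-1 invariant**: on a `KL`-configuration in which `c` carries a closed edge to `K`, `c` is the
carrier itself, so it also carries a closed edge to `L`. -/
theorem Acyclic.carries_b_of_carries_a [DecidableEq E] (hG : G.Acyclic) {S : Config E} {a b c : V}
    (hbot : G.IsBot S a b c) (hKL : G.Conn (G.kSwap c S) a b) (hc : G.Carries S c a) :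
    G.Carries S c b := by
  obtain ⟨x, hcx, ⟨eK, uK, heK, hjK, huK⟩, hxb⟩ := hG.exists_carrier hbot hKL
  obtain ⟨g, z, hg, hjg, haz⟩ := hc
  have hcx' : c = x := by
    by_cases hge : g = eK
    · subst hge
      rcases JoinsV.eq_or_eq hjg hjK with ⟨h1, -⟩ | ⟨h1, -⟩
      · exact h1
      · have h3 : G.Conn S a c := by rw [h1]; exact huK
        exact absurd h3 hbot.2.1
    · exact absurd (hG.not_two_closed' hg hge hjg hjK hcx (haz.symm.trans huK)) id
  rw [hcx']; exact hxb

section Phi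

variable [DecidableEq E] (hG : G.Acyclic) (a b c : V)

/-- A chosen witness for a `KL`-configuration whose `c` does not carry to `K`. -/
noncomputable def klWitness {S : Config E} (h : G.BotM S a b c ∧ ¬ G.Carries S c a) :
    G.KLWitness S a b c :=
  Classical.choice (hG.nonempty_klWitness h.1.1 h.1.2 h.2)

open Classical in
/-- **The injection `Φ`**: a `KL`-configuration in which `c` carries a closed edge to `K` is its own image;
otherwise the first edge of the open path `c → x` is closed and the edge of the carrier `x` towards `a` is
opened. -/
noncomputable def phi (S : Config E) : Config E :=
  if h : G.BotM S a b c ∧ ¬ G.Carries S c a then (G.klWitness hG a b c h).T else S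

/-- `Φ` in the second case. -/
theorem phi_of_pos {S : Config E} (h : G.BotM S a b c ∧ ¬ G.Carries S c a) :
    G.phi hG a b c S = (G.klWitness hG a b c h).T := by
  unfold phi; rw [dif_pos h]

/-- `Φ` in the first case (and off `KL`). -/
theorem phi_of_neg {S : Config E} (h : ¬ (G.BotM S a b c ∧ ¬ G.Carries S c a)) :
    G.phi hG a b c S = S := by
  unfold phi; rw [dif_neg h]

/-- `Φ` lands in `A = {bot ∧ τ₅₀ ∈ ac|b}`. -/
theorem phi_mem {S : Config E} (hS : G.BotM S a b c) :
    G.IsBot (G.phi hG a b c S) a b c ∧ G.CellAC (G.kSwapSealed c b (G.phi hG a b c S)) a b c := by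
  by_cases hc : G.Carries S c a
  · rw [G.phi_of_neg hG a b c (fun h => h.2 hc)]
    exact ⟨hS.1, G.cellAC_kSwapSealed_of_carries hS.1 hc⟩
  · have h : G.BotM S a b c ∧ ¬ G.Carries S c a := ⟨hS, hc⟩
    rw [G.phi_of_pos hG a b c h]
    have hbotT := (G.klWitness hG a b c h).isBot_T hG hS.1
    exact ⟨hbotT, G.cellAC_kSwapSealed_of_carries hbotT
      ((G.klWitness hG a b c h).carries_T_c_a hS.1)⟩

/-- `Φ` is injective on `KL`. -/
theorem phi_inj {S S' : Config E} (hS : G.BotM S a b c) (hS' : G.BotM S' a b c)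
    (h : G.phi hG a b c S = G.phi hG a b c S') : S = S' := by
  by_cases hc : G.Carries S c a <;> by_cases hc' : G.Carries S' c a
  · rwa [G.phi_of_neg hG a b c (fun h => h.2 hc), G.phi_of_neg hG a b c (fun h => h.2 hc')] at h
  · exfalso
    have h1 : G.Carries S c b := hG.carries_b_of_carries_a hS.1 hS.2 hc
    have h2 : ¬ G.Carries (G.phi hG a b c S') c b := by
      rw [G.phi_of_pos hG a b c ⟨hS', hc'⟩]
      exact (G.klWitness hG a b c ⟨hS', hc'⟩).not_carries_T_c_b hG hS'.1
    rw [G.phi_of_neg hG a b c (fun h => h.2 hc)] at h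
    rw [← h] at h2; exact h2 h1
  · exfalso
    have h1 : G.Carries S' c b := hG.carries_b_of_carries_a hS'.1 hS'.2 hc'
    have h2 : ¬ G.Carries (G.phi hG a b c S) c b := by
      rw [G.phi_of_pos hG a b c ⟨hS, hc⟩]
      exact (G.klWitness hG a b c ⟨hS, hc⟩).not_carries_T_c_b hG hS.1
    rw [G.phi_of_neg hG a b c (fun h => h.2 hc')] at h
    rw [h] at h2; exact h2 h1
  · rw [G.phi_of_pos hG a b c ⟨hS, hc⟩, G.phi_of_pos hG a b c ⟨hS', hc'⟩] at h
    set w := G.klWitness hG a b c ⟨hS, hc⟩ with hw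
    set w' := G.klWitness hG a b c ⟨hS', hc'⟩ with hw'
    have hbotT : G.IsBot w.T a b c := w.isBot_T hG hS.1
    have hax' : G.Conn w.T a w'.x := by rw [h]; exact w'.conn_T_a_x hS'.1
    have hbu' : G.Conn w.T b w'.uL := by rw [h]; exact w'.conn_T_b_uL hS'.1
    have hay' : G.Conn w.T a w'.y₁ := by rw [h]; exact w'.conn_T_a_y₁ hS'.1
    -- the closed `K_T`–`L_T` edge is unique
    have heL : w.eL = w'.eL := by
      by_contra hne
      exact hG.not_two_closed' (w.T_eL hS.1) hne w.hjL w'.hjL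
        ((w.conn_T_a_x hS.1).symm.trans hax') ((w.conn_T_b_uL hS.1).symm.trans hbu')
    have hx : w.x = w'.x := by
      have hjL' : G.JoinsV w.eL w'.x w'.uL := by rw [heL]; exact w'.hjL
      rcases JoinsV.eq_or_eq w.hjL hjL' with ⟨h1, -⟩ | ⟨h1, -⟩
      · exact h1
      · exfalso
        have h3 : G.Conn w.T a w'.uL := by rw [← h1]; exact w.conn_T_a_x hS.1
        exact hbotT.1 (h3.trans hbu'.symm)
    -- the closed `M_T`–`K_T` edge is unique
    have he₁ : w.e₁ = w'.e₁ := by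
      by_contra hne
      exact hG.not_two_closed' w.T_e₁ hne w.hj₁ w'.hj₁ (Conn.refl G _ c)
        ((w.conn_T_a_y₁ hS.1).symm.trans hay')
    -- the separating open edge at `x` is unique
    have heK : w.eK = w'.eK := by
      refine hG.sep_edge_unique (u' := w'.uK) w.T_eK ?_ w.hjK ?_ (w.not_conn_update_T_eK hS.1) ?_
        (w.conn_T_a_x hS.1)
      · rw [h]; exact w'.T_eK
      · rw [hx]; exact w'.hjK
      · rw [h, hx]; exact w'.not_conn_update_T_eK hS'.1
    refine w.eq_update_T.trans ?_
    rw [h, heK, he₁]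
    exact w'.eq_update_T.symm

end Phi

open Classical in
/-- **Forests are D-free, one-sided form**: on an acyclic marked multigraph, `#KL ≤ #{bot : τ₅₀ ∈ ac|b}`. -/
theorem Acyclic.card_botM_le [Fintype E] [DecidableEq E] (hG : G.Acyclic) (a b c : V) :
    (Finset.univ.filter fun ω : Config E => G.BotM ω a b c).card ≤
      (Finset.univ.filter fun ω : Config E =>
        G.IsBot ω a b c ∧ G.CellAC (G.kSwapSealed c b ω) a b c).card := by
  classical
  refine Finset.card_le_card_of_injOn (G.phi hG a b c) ?_ ?_
  · intro S hS
    simp only [Finset.coe_filter, Finset.mem_univ, true_and, Set.mem_setOf_eq] at hS ⊢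
    exact G.phi_mem hG a b c hS
  · intro S hS S' hS' h
    simp only [Finset.coe_filter, Finset.mem_univ, true_and, Set.mem_setOf_eq] at hS hS'
    exact G.phi_inj hG a b c hS hS' h

open Classical in
/-- **THEOREM F — forests are D-free** (proofs/P6-forest-dfree.md): `DFreeIneq` on every acyclic marked
multigraph. -/
theorem Acyclic.dFreeIneq [Fintype E] [DecidableEq E] (hG : G.Acyclic) (a b c : V) :
    G.DFreeIneq a b c := by
  unfold DFreeIneq
  refine le_trans ?_ (Nat.le_add_right _ _)
  exact Acyclic.card_botM_le hG a b c

end MultiGraph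

end PercRepro
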